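import Summits.RiemannHypothesis.RiemannHypothesis.Theorems.SuzukiStructureFunctionsConvolution

/-!
# SuzukiStructureFunctionsParity — Prop. 3.1 of Suzuki JFA21: the representation (3.28), parity, decay and
# continuity of the special functions `𝔉(t,·)`, `𝔊(t,·)` on a solvable window (column DBR; RH-FREE)

LINE 1 — LABEL: RH-FREE (identities/estimates for ANY Suzuki pair `(ϱ, K)` on any solvable window; no `ζ`, no
zeros, no positivity); bears_on LADDER-RH B-D → B-P(P1)/(P3) (the column's de Branges object `E(t,z)`).
WHAT THIS IS NOT: not progress toward RH; nothing here bears on the truth of RH.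

Source: M. Suzuki, J. Funct. Anal. 281 (2021) 109116 = arXiv:1606.05726 [Suzuki2021Hamiltonians], Prop. 3.1,
eq. (3.28); Prop. 3.2 (continuity clause).

Contents (seat rh-dbr-eng-5 g7; continuation of `SuzukiStructureFunctionsConvolution`):
* `frakFG_eq_repr` — **(3.28)**: `frakFG ε (t,x) = ½(ϱ(x−t) + εϱ(−x−t)) − (ε/2)∫_{(−∞,t]}(ϱ(x−y) + εϱ(−x−y))φ^ε(t,y) dy`
  (`ε = 1`: `𝔉`, `ε = −1`: `𝔊`), from (3.9);
* `frakFG_neg`, `frakF_neg`, `frakG_neg` — **parity**: `𝔉(t,·)` even, `𝔊(t,·)` odd;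
* `frakFG_decay` — **decay**: `|𝔉(t,x)|, |𝔊(t,x)| ≪_n e^{−n|x|}` for every `n`;
* `continuous_frakFG` — continuity in `x`; `integrable_frakFG_mul_cexp` — the integrals (3.27) converge
  absolutely for every complex `z`.
(Reality is automatic: `ϱ`, `K`, `φ^ε` and hence `𝔉`, `𝔊` are real-valued by construction.)
-/

noncomputable section

-- D-0017: `Summit.<S>.<S>.…` is the designed namespace of a single-problem summit.
set_option linter.dupNamespace false

open MeasureTheory Set Complex Filter Topology
open scoped ComplexConjugate

namespace Summit.RiemannHypothesis.RiemannHypothesis.Theorems.SuzukiStructureFunctions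

open Literature.NumberTheory.LFunctions Literature.NumberTheory.LFunctions.SuzukiStructure
open Summit.RiemannHypothesis.RiemannHypothesis.Theorems.SuzukiPhiExistence
  (continuous_suzukiPhiExt setIntegral_Iic_kernel_mul_suzukiPhiExt_eq)

variable {ϱ K : ℝ → ℝ} {ε t : ℝ}

/-! ## §7 Prop. 3.1: the representation (3.28), parity, decay and continuity of `𝔉(t,·)`, `𝔊(t,·)` -/

/-- RH-FREE. Uniform decay of `y`-translates over a bounded `y`-range: from `|ϱ| ≪_n e^{−n|·|}`, for every
`n` and `R` there is `C ≥ 0` with `|ϱ(x−y)| ≤ C e^{−n|x|}` and `|ϱ(−x−y)| ≤ C e^{−n|x|}` whenever `|y| ≤ R`. -/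
theorem decay_uniform_shift (hdec : ∀ n : ℝ, ∃ C : ℝ, ∀ x : ℝ, |ϱ x| ≤ C * Real.exp (-(n * |x|))) (n R : ℝ) :
    ∃ C : ℝ, 0 ≤ C ∧ ∀ x y : ℝ, |y| ≤ R →
      |ϱ (x - y)| ≤ C * Real.exp (-(n * |x|)) ∧ |ϱ (-x - y)| ≤ C * Real.exp (-(n * |x|)) := by
  obtain ⟨C, hC⟩ := hdec |n|
  have hC0 : 0 ≤ C := by
    have := (abs_nonneg _).trans (hC 0)
    simpa using this
  refine ⟨C * Real.exp (|n| * R), by positivity, fun x y hy => ?_⟩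
  have key : ∀ u : ℝ, |u| ≥ |x| - R → C * Real.exp (-(|n| * |u|)) ≤ C * Real.exp (|n| * R) * Real.exp (-(n * |x|)) := by
    intro u hu
    rw [mul_assoc, ← Real.exp_add]
    refine mul_le_mul_of_nonneg_left (Real.exp_le_exp.2 ?_) hC0
    have h1 : n * |x| ≤ |n| * |x| := mul_le_mul_of_nonneg_right (le_abs_self n) (abs_nonneg x)
    nlinarith [abs_nonneg n, abs_nonneg u, abs_nonneg x]
  constructor
  · refine (hC (x - y)).trans (key (x - y) ?_)
    have := abs_sub_abs_le_abs_sub x y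
    linarith
  · refine (hC (-x - y)).trans (key (-x - y) ?_)
    have h := abs_sub_abs_le_abs_sub (-x) y
    rw [abs_neg] at h
    linarith

/-- RH-FREE. On a solvable window, `y ↦ ϱ(a − y)·φ^ε(t,y)` and `y ↦ ϱ(−a − y)·φ^ε(t,y)` are integrable on `ℝ`
(super-exponential decay of `ϱ` against the exponential growth of `φ^ε(t,·)`, Lemma 3.7). -/
theorem integrable_rho_shift_mul_suzukiPhiExt (h : IsSuzukiPair ϱ K)
    (hsol : ∃ X : ℝ → ℝ, IsSuzukiPhiSolution K ε t X) (a : ℝ) :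
    Integrable (fun y : ℝ => ϱ (a - y) * suzukiPhiExt K ε t y) ∧
      Integrable (fun y : ℝ => ϱ (-a - y) * suzukiPhiExt K ε t y) := by
  obtain ⟨c, CK, hc, hKle⟩ := h.abs_kernel_le
  have hK3 : ∀ u : ℝ, u < 0 → K u = 0 := fun u hu => h.kernel_eq_zero u hu.le
  obtain ⟨C, hC⟩ := abs_suzukiPhiExt_le hK3 hc hKle hsol
  have hφc : Continuous (suzukiPhiExt K ε t) := continuous_suzukiPhiExt h.continuous_kernel hK3 ε t
  have hd : ∀ b : ℝ, ∀ n : ℝ, ∃ C : ℝ, ∀ y : ℝ, |ϱ (b - y)| ≤ C * Real.exp (-(n * |y|)) := by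
    intro b n
    obtain ⟨C, hC⟩ := decay_comp_sub (decay_comp_neg h.abs_rho_le) b n
    exact ⟨C, fun y => by simpa [neg_sub] using hC y⟩
  exact ⟨integrable_decay_mul_growth (h.continuous_rho.comp (continuous_const.sub continuous_id)) (hd a)
      hφc hC,
    integrable_decay_mul_growth (h.continuous_rho.comp (continuous_const.sub continuous_id)) (hd (-a))
      hφc hC⟩

/-- RH-FREE. **Prop. 3.1, eq. (3.28) (both lines at once, for `ε = ±1` or indeed any real `ε` whose window
is solvable):**
`frakFG ε (t,x) = ½(ϱ(x−t) + εϱ(−x−t)) − (ε/2)∫_{(−∞,t]} (ϱ(x−y) + εϱ(−x−y)) φ^ε(t,y) dy`;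
for `ε = 1`: `𝔉(t,x) = ½(ϱ(x−t)+ϱ(−x−t)) − ½∫_{−∞}^t (ϱ(x−y)+ϱ(−x−y))φ⁺(t,y) dy`, for `ε = −1`:
`𝔊(t,x) = ½(ϱ(x−t)−ϱ(−x−t)) + ½∫_{−∞}^t (ϱ(x−y)−ϱ(−x−y))φ⁻(t,y) dy` («obtained easily by applying (3.9) to
definition (3.26)»). -/
theorem frakFG_eq_repr (h : IsSuzukiPair ϱ K) (hsol : ∃ X : ℝ → ℝ, IsSuzukiPhiSolution K ε t X) (x : ℝ) :
    frakFG ϱ K ε t x = 1 / 2 * (ϱ (x - t) + ε * ϱ (-x - t)) -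
      ε / 2 * ∫ y in Iic t, (ϱ (x - y) + ε * ϱ (-x - y)) * suzukiPhiExt K ε t y := by
  set φ := suzukiPhiExt K ε t with hφ
  obtain ⟨hi1, hi2⟩ := integrable_rho_shift_mul_suzukiPhiExt h hsol x
  have h39 := rho_conv_suzukiPhiExt_eq h hsol x
  -- `∫_{(t,∞)} = ∫_ℝ − ∫_{(−∞,t]}`
  have hIoi : ∫ y in Ioi t, ϱ (x - y) * φ y = (∫ y : ℝ, ϱ (x - y) * φ y) - ∫ y in Iic t, ϱ (x - y) * φ y := by
    rw [← intervalIntegral.integral_Iic_add_Ioi hi1.integrableOn hi1.integrableOn]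
    ring
  have hsum : ∫ y in Iic t, (ϱ (x - y) + ε * ϱ (-x - y)) * φ y =
      (∫ y in Iic t, ϱ (x - y) * φ y) + ε * ∫ y in Iic t, ϱ (-x - y) * φ y := by
    rw [← integral_const_mul, ← integral_add hi1.integrableOn (hi2.integrableOn.const_mul ε)]
    refine integral_congr_ae (Eventually.of_forall fun y => ?_)
    simp only
    ring
  rw [frakFG, ← hφ, hIoi, hsum]
  have e : ∫ y : ℝ, ϱ (x - y) * φ y = ϱ (-x - t) - ε * ∫ y in Iic t, ϱ (-x - y) * φ y := by
    rw [← h39]; ring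
  rw [e]
  ring

/-- RH-FREE. **Prop. 3.1, parity: `𝔉(t,·)` is even and `𝔊(t,·)` is odd** — `frakFG ε (t,−x) = ε·frakFG ε (t,x)`
for `ε = ±1` on a solvable window. -/
theorem frakFG_neg (h : IsSuzukiPair ϱ K) (hε : ε = 1 ∨ ε = -1)
    (hsol : ∃ X : ℝ → ℝ, IsSuzukiPhiSolution K ε t X) (x : ℝ) :
    frakFG ϱ K ε t (-x) = ε * frakFG ϱ K ε t x := by
  have hε2 : ε * ε = 1 := by rcases hε with rfl | rfl <;> norm_num
  rw [frakFG_eq_repr h hsol (-x), frakFG_eq_repr h hsol x, neg_neg]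
  have hg : (fun y : ℝ => (ϱ (-x - y) + ε * ϱ (x - y)) * suzukiPhiExt K ε t y) =
      fun y => ε * ((ϱ (x - y) + ε * ϱ (-x - y)) * suzukiPhiExt K ε t y) := by
    funext y
    linear_combination (-(ϱ (-x - y) * suzukiPhiExt K ε t y)) * hε2
  rw [hg, integral_const_mul]
  linear_combination (-(1 / 2) * ϱ (-x - t)) * hε2

/-- RH-FREE. `𝔉(t,·)` is even: `𝔉(t,−x) = 𝔉(t,x)` (Prop. 3.1). -/
theorem frakF_neg (h : IsSuzukiPair ϱ K) (hsol : ∃ X : ℝ → ℝ, IsSuzukiPhiSolution K 1 t X) (x : ℝ) :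
    frakF ϱ K t (-x) = frakF ϱ K t x := by
  rw [frakF, frakF, frakFG_neg h (Or.inl rfl) hsol x, one_mul]

/-- RH-FREE. `𝔊(t,·)` is odd: `𝔊(t,−x) = −𝔊(t,x)` (Prop. 3.1). -/
theorem frakG_neg (h : IsSuzukiPair ϱ K) (hsol : ∃ X : ℝ → ℝ, IsSuzukiPhiSolution K (-1) t X) (x : ℝ) :
    frakG ϱ K t (-x) = -frakG ϱ K t x := by
  rw [frakG, frakG, frakFG_neg h (Or.inr rfl) hsol x, neg_one_mul]

/-- RH-FREE. `∫_{(−∞,t]} g(y)φ^ε(t,y) dy = ∫_{[−t,t]} g(y)φ^ε(t,y) dy` (the solution vanishes on `(−∞,−t)`). -/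
theorem setIntegral_Iic_mul_suzukiPhiExt_eq_Icc (hK3 : ∀ u : ℝ, u < 0 → K u = 0) (g : ℝ → ℝ) (ε t : ℝ) :
    ∫ y in Iic t, g y * suzukiPhiExt K ε t y = ∫ y in Icc (-t) t, g y * suzukiPhiExt K ε t y := by
  rw [setIntegral_Iic_mul_suzukiPhiExt_eq hK3 g ε t]
  exact setIntegral_congr_set (Ioo_ae_eq_Icc (μ := (volume : Measure ℝ)))

/-- RH-FREE. **Prop. 3.1, decay: `|𝔉(t,x)|, |𝔊(t,x)| ≪_n e^{−n|x|}` for every `n`** («where the implied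
constant depends on `t`»), on a solvable window. -/
theorem frakFG_decay (h : IsSuzukiPair ϱ K) (hsol : ∃ X : ℝ → ℝ, IsSuzukiPhiSolution K ε t X) (n : ℝ) :
    ∃ C : ℝ, ∀ x : ℝ, |frakFG ϱ K ε t x| ≤ C * Real.exp (-(n * |x|)) := by
  have hK3 : ∀ u : ℝ, u < 0 → K u = 0 := fun u hu => h.kernel_eq_zero u hu.le
  set φ := suzukiPhiExt K ε t with hφ
  have hφc : Continuous φ := continuous_suzukiPhiExt h.continuous_kernel hK3 ε t
  -- a bound for `φ` on `[−t,t]`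
  obtain ⟨M, hM⟩ := (isCompact_Icc (a := -t) (b := t)).exists_bound_of_continuousOn hφc.continuousOn
  set M' : ℝ := max M 0 with hM'
  have hM'0 : 0 ≤ M' := le_max_right _ _
  obtain ⟨C, hC0, hC⟩ := decay_uniform_shift h.abs_rho_le n |t|
  set V : ℝ := (volume : Measure ℝ).real (Icc (-t) t) with hV
  have hV0 : 0 ≤ V := measureReal_nonneg
  refine ⟨1 / 2 * (C + |ε| * C) + |ε| / 2 * ((C + |ε| * C) * M' * V), fun x => ?_⟩
  rw [frakFG_eq_repr h hsol x, setIntegral_Iic_mul_suzukiPhiExt_eq_Icc hK3 _ ε t, ← hφ]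
  obtain ⟨hx1, hx2⟩ := hC x t le_rfl
  set ex : ℝ := Real.exp (-(n * |x|)) with hex
  have hex0 : 0 ≤ ex := (Real.exp_pos _).le
  -- the integral term
  have hint : ‖∫ y in Icc (-t) t, (ϱ (x - y) + ε * ϱ (-x - y)) * φ y‖ ≤ (C + |ε| * C) * ex * M' * V := by
    refine norm_setIntegral_le_of_norm_le_const measure_Icc_lt_top fun y hy => ?_
    have hyt : |y| ≤ |t| :=
      abs_le.2 ⟨by linarith [hy.1, le_abs_self t], hy.2.trans (le_abs_self t)⟩
    obtain ⟨hy1, hy2⟩ := hC x y hyt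
    have hφy : |φ y| ≤ M' := by
      have := hM y hy
      rw [Real.norm_eq_abs] at this
      exact this.trans (le_max_left _ _)
    rw [Real.norm_eq_abs, abs_mul]
    refine mul_le_mul ?_ hφy (abs_nonneg _) (by positivity)
    calc |ϱ (x - y) + ε * ϱ (-x - y)| ≤ |ϱ (x - y)| + |ε| * |ϱ (-x - y)| := by
          rw [← abs_mul]; exact abs_add_le _ _
      _ ≤ C * ex + |ε| * (C * ex) := by gcongr
      _ = (C + |ε| * C) * ex := by ring
  rw [Real.norm_eq_abs] at hint
  calc |1 / 2 * (ϱ (x - t) + ε * ϱ (-x - t)) -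
        ε / 2 * ∫ y in Icc (-t) t, (ϱ (x - y) + ε * ϱ (-x - y)) * φ y|
      ≤ |1 / 2 * (ϱ (x - t) + ε * ϱ (-x - t))| +
        |ε / 2 * ∫ y in Icc (-t) t, (ϱ (x - y) + ε * ϱ (-x - y)) * φ y| := abs_sub _ _
    _ = 1 / 2 * |ϱ (x - t) + ε * ϱ (-x - t)| +
        |ε| / 2 * |∫ y in Icc (-t) t, (ϱ (x - y) + ε * ϱ (-x - y)) * φ y| := by
        rw [abs_mul, abs_mul, abs_div, abs_div, abs_one, abs_two]
    _ ≤ 1 / 2 * (C * ex + |ε| * (C * ex)) + |ε| / 2 * ((C + |ε| * C) * ex * M' * V) := by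
        gcongr
        calc |ϱ (x - t) + ε * ϱ (-x - t)| ≤ |ϱ (x - t)| + |ε * ϱ (-x - t)| := abs_add_le _ _
          _ = |ϱ (x - t)| + |ε| * |ϱ (-x - t)| := by rw [abs_mul]
          _ ≤ C * ex + |ε| * (C * ex) := by gcongr
    _ = (1 / 2 * (C + |ε| * C) + |ε| / 2 * ((C + |ε| * C) * M' * V)) * ex := by ring

/-- RH-FREE. **Prop. 3.2, continuity clause in `x`: `𝔉(t,·)`, `𝔊(t,·)` are continuous on `ℝ`** (from the
representation (3.28): a translate of `ϱ` plus a parametric integral over the compact window `[−t,t]`). -/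
theorem continuous_frakFG (h : IsSuzukiPair ϱ K) (hsol : ∃ X : ℝ → ℝ, IsSuzukiPhiSolution K ε t X) :
    Continuous (frakFG ϱ K ε t) := by
  have hK3 : ∀ u : ℝ, u < 0 → K u = 0 := fun u hu => h.kernel_eq_zero u hu.le
  have hφc : Continuous (suzukiPhiExt K ε t) := continuous_suzukiPhiExt h.continuous_kernel hK3 ε t
  have e : frakFG ϱ K ε t = fun x => 1 / 2 * (ϱ (x - t) + ε * ϱ (-x - t)) -
      ε / 2 * ∫ y in Icc (-t) t, (ϱ (x - y) + ε * ϱ (-x - y)) * suzukiPhiExt K ε t y := by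
    funext x
    rw [frakFG_eq_repr h hsol x, setIntegral_Iic_mul_suzukiPhiExt_eq_Icc hK3 _ ε t]
  rw [e]
  have hρ := h.continuous_rho
  refine ((continuous_const.mul ((hρ.comp (continuous_id.sub continuous_const)).add
    (continuous_const.mul (hρ.comp ((continuous_neg).sub continuous_const))))).sub
    (continuous_const.mul ?_))
  refine continuous_parametric_integral_of_continuous
    (f := fun x y => (ϱ (x - y) + ε * ϱ (-x - y)) * suzukiPhiExt K ε t y) ?_ isCompact_Icc
  exact (((hρ.comp (continuous_fst.sub continuous_snd)).add
    (continuous_const.mul (hρ.comp (continuous_fst.neg.sub continuous_snd)))).mul (hφc.comp continuous_snd))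

/-- RH-FREE. `𝔉(t,·)`, `𝔊(t,·)` are real-valued with super-exponential decay, hence `x ↦ 𝔉(t,x)e^{izx}` is
integrable for every complex `z` (the integrals (3.27) converge absolutely on all of `ℂ`). -/
theorem integrable_frakFG_mul_cexp (h : IsSuzukiPair ϱ K) (hsol : ∃ X : ℝ → ℝ, IsSuzukiPhiSolution K ε t X)
    (z : ℂ) : Integrable fun x : ℝ => (frakFG ϱ K ε t x : ℂ) * cexp (I * z * x) :=
  integrable_mul_cexp_of_decay (continuous_frakFG h hsol) (frakFG_decay h hsol) z

end Summit.RiemannHypothesis.RiemannHypothesis.Theorems.SuzukiStructureFunctions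

end
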